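import Literature.AlgebraicGeometry.HodgeTheory.AbelianVarietyTwoClassNormalFormSelfIntersection
import Literature.AlgebraicGeometry.HodgeTheory.AbelianVarietyCupMonomialCofactorSigns
import HarnessLib

/-!
# The penultimate power of an integral `2`-class in normal form: `θ = Σ_{i≤k} dᵢ·v_{2i} ⌣ v_{2i+1}` ⇒ `θ^{⌣k} = k!·Σᵢ (∏_{l≠i} d_l)·(the cup monomial of the pairs ≠ i)` on `H•(A(ℂ); ℤ)`

Layer `Literature/AlgebraicGeometry/HodgeTheory`, namespace `Literature.AlgebraicGeometry.HodgeTheory` (theorems about `A(ℂ)` in the `AbelianVariety` namespace).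
THEOREMS ONLY (no definition, no named fact, no instance, no notation; D-0026 net debt 0).  Sequel of `AbelianVarietyTwoClassNormalFormSelfIntersection`
(g46-#3: the TOP power `θ^{⌣k} = k!·d₁⋯d_k·m_{2k}(v)` of a `k`-pair normal form).  Here: the power ONE BELOW THE TOP of a `(k+1)`-pair normal form — the divided
power `θ^{⌣k}/k!` is the `k`-th elementary symmetric combination of the symplectic pairs, the cohomological shape of Poincaré's formula at `n = 1`
(«`[W̃₁] = θ^{g−1}/(g−1)!`»: on a Jacobian the divided power `θ^{g−1}/(g−1)!` is the class of the curve) and of the «minimal class».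

THE PRINTS.  H. Lange, *Abelian Varieties over the Complex Numbers* (2023) [Lange2023AbelianVarietiesComplex] (held text `book:lange1992-complex-abelian-varieties`),
VERBATIM: §1.7 proof of **Theorem 1.7.3 (Geometric Riemann–Roch)** [p0073 L19–L23] «`∧^g c₁(L) = (−1)^g g! d₁ ⋯ d_g dx₁ ∧ dy₁ ∧ ⋯ ∧ dx_g ∧ dy_g`» for
`c₁(L) = −Σ dᵢ dxᵢ ∧ dyᵢ` (Lemma 1.7.5) — the same expansion one degree lower gives `∧^{g−1} c₁(L) = (−1)^{g−1} (g−1)! Σᵢ (∏_{ν≠i} d_ν) dx₁∧dy₁∧⋯∧\widehat{dxᵢ∧dyᵢ}∧⋯∧dx_g∧dy_g`,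
which is the computation formalised here; §4.2 [p0203 L15] «**Theorem 4.2.2 (Poincaré's Formula)** `[W̃_n] = (1/(g−n)!) ∧^{g−n}[Θ]` for any `1 ≤ n ≤ g`»; §1.1.3
Lemma 1.1.17 (b) (`Hⁿ(X, ℤ) = ∧ⁿ H¹(X, ℤ)` by the cup product).  D. Mumford, *Abelian Varieties* (1970) [MumfordAV1970] §16 (Riemann–Roch) and §1 (4).  A. Hatcher,
*Algebraic Topology* (2002) [HatcherAT2002] §3.2 Prop. 3.10, Thm. 3.11, Example 3.16 (`H•(T^{2g}; ℤ) = Λ_ℤ[α₁, …, α_{2g}]`).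

On the ALGEBRAIC Betti carrier `Hⁿ = singularCohomology ℤ ℤ (ComplexPoints A.X) n`, with `m_n(w) = cupPowOne ℤ _ n w = w₀ ⌣ ⋯ ⌣ w_{n−1}`, `cupPowL c k = c^{⌣k}`, and, for
`v : Fin (2(k+1)) → H¹`, `d : Fin (k+1) → ℤ`, `i ≤ k`,

  `θ(d, v) = Σ_{i ≤ k} dᵢ · (v_{2i} ⌣ v_{2i+1}) ∈ H²`,   `v^{(i)} : Fin (2k) → H¹, t ↦ v_{2·sᵢ(⌊t/2⌋) + (t mod 2)}`  (`sᵢ = Fin.succAbove i`; the family `v` with the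
  pair `(v_{2i}, v_{2i+1})` OMITTED — SPELLED OUT in every statement, no definition is introduced):

* §1 plumbing (private re-indexing `v^{(0)} = (v₂, v₃, …)`) and **`cupPowOne_omitPair_succ_eq`**: `m_{2k+2}(v^{(i+1)}) = (v₀ ⌣ v₁) ⌣ m_{2k}((v₂, v₃, …)^{(i)})`,
  `∏_{l} d_{s₀(l)} = ∏_{l} d_{l+1}`, `∏_{l} d_{s_{i+1}(l)} = d₀ · ∏_{l} d_{s_i(l)+1}`;
* §2 **`cupPowL_sum_pair_succ_eq_factorial_smul_sum`** — THE IDENTITY `θ(d, v)^{⌣k} = k! · Σ_{i ≤ k} (∏_{l < k} d_{sᵢ(l)}) · m_{2k}(v^{(i)})`, by induction on `k`: peel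
  `θ = d₀·(v₀ ⌣ v₁) + θ'`, expand `(a + θ')^{⌣(k+1)} = θ'^{⌣(k+1)} + (k+1)·a ⌣ θ'^{⌣k}` for the square-zero summand `a` (the tree's `cupPowL_add_succ_of_sq_zero`), use
  the top power of `θ'` (g46-#3) and the induction hypothesis for `θ'^{⌣k}`; `cupPowL_sum_pair_succ_eq_factorial_smul_sum_principal` (all `dᵢ = 1`:
  `θ^{⌣k} = k! · Σᵢ m_{2k}(v^{(i)})` — «`θ^{g−1}/(g−1)!`» is the sum of the `g` coordinate `(g−1)`-fold pair monomials); `cupPowL_sum_pair_succ_eq_zero_of_two_le`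
  (`θ^{⌣k} = 0` as soon as two distinct `dᵢ, d_j` vanish);
* §3 **`cupProduct_pair_cupPowOne_omitPair`** (`(v_{2i} ⌣ v_{2i+1}) ⌣ m_{2k}(v^{(i)}) = m_{2k+2}(v)`, via the tree's cofactor signs `x_j ⌣ m_{−j} = (−1)^j m`,
  `AbelianVarietyCupMonomialCofactorSigns`), `cupProduct_pair_cupPowOne_omitPair_of_ne` (`= 0` against `v^{(l)}`, `l ≠ i`), and
  **`cupProduct_pair_cupPowL_sum_pair_succ`** — `(v_{2i} ⌣ v_{2i+1}) ⌣ θ^{⌣k} = (k!·∏_{l≠i} d_l)·m_{2k+2}(v)` (principal case `= k!·m_{2k+2}(v)`: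
  `cupProduct_pair_cupPowL_sum_pair_succ_principal`).

## References

* [Lange2023AbelianVarietiesComplex] H. Lange, *Abelian Varieties over the Complex Numbers*, Springer 2023 — §1.7 Thm. 1.7.3 and its proof (PDF p. 73), Lemma 1.7.5; §4.2
  Thm. 4.2.2 (Poincaré's formula, PDF p. 203); §1.1.3 Lemma 1.1.17 (b).
* [MumfordAV1970] D. Mumford, *Abelian Varieties*, 1970 — §1 (4), §16.
* [HatcherAT2002] A. Hatcher, *Algebraic Topology*, CUP 2002 — §3.2 Prop. 3.10, Thm. 3.11, Example 3.16.
* [BourbakiAlgebraI1989] N. Bourbaki, *Algebra I. Chapters 1–3*, Springer 1989 — Ch. III §7 no. 8 (19)–(20) (signs of products of exterior monomials).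

## Provenance

lit-hodgefound prover seat p21, generation 47, row g47-#2 (own row, claimed by path; successor note (i) of generation 46; sequel of g46-#3, g46-#8 and g43-#2).
-/

noncomputable section

open Module Function Finset
open Literature.AlgebraicTopology.SingularHomology
open Literature.Topology.FourManifolds

universe u v

namespace Literature.AlgebraicGeometry.HodgeTheory

namespace AbelianVariety

open Literature.AlgebraicGeometry.Motives (ComplexPoints IsSmoothProjective AbelianVariety)

variable (A : AbelianVariety ℂ)

/-! ### §1 Plumbing: bilinearity, peeling, and the re-indexing of the omitted-pair families -/

/-- Plumbing: integer multiples move out of the left factor of a cup product. [cite: HatcherAT2002, §3.2 p. 211 (bilinearity of `⌣`)] -/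
private theorem cupProduct_zsmul_left' {p q n : ℕ} (h : p + q = n) (c : ℤ) (a : singularCohomology ℤ ℤ (ComplexPoints A.X) p)
    (b : singularCohomology ℤ ℤ (ComplexPoints A.X) q) : cupProduct h (c • a) b = c • cupProduct h a b := by
  rw [map_zsmul]
  rfl

/-- Plumbing: integer multiples move out of the right factor of a cup product. [cite: HatcherAT2002, §3.2 p. 211 (bilinearity of `⌣`)] -/
private theorem cupProduct_zsmul_right' {p q n : ℕ} (h : p + q = n) (c : ℤ) (a : singularCohomology ℤ ℤ (ComplexPoints A.X) p)
    (b : singularCohomology ℤ ℤ (ComplexPoints A.X) q) : cupProduct h a (c • b) = c • cupProduct h a b :=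
  map_zsmul _ _ _

/-- Plumbing: finite sums move out of the right factor of a cup product. [cite: HatcherAT2002, §3.2 p. 211 (bilinearity of `⌣`)] -/
private theorem cupProduct_sum_right' {p q n : ℕ} (h : p + q = n) {ι : Type*} (s : Finset ι) (a : singularCohomology ℤ ℤ (ComplexPoints A.X) p)
    (b : ι → singularCohomology ℤ ℤ (ComplexPoints A.X) q) : cupProduct h a (∑ i ∈ s, b i) = ∑ i ∈ s, cupProduct h a (b i) :=
  map_sum _ _ _

/-- Plumbing: integer multiples distribute over finite sums in `Hⁿ(A(ℂ); ℤ)` (the `ℤ`-action of the additive group). [folklore] -/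
private theorem zsmul_sum' {n : ℕ} {ι : Type*} (s : Finset ι) (c : ℤ) (f : ι → singularCohomology ℤ ℤ (ComplexPoints A.X) n) :
    c • ∑ i ∈ s, f i = ∑ i ∈ s, c • f i := by
  induction s using Finset.cons_induction with
  | empty => rw [Finset.sum_empty, Finset.sum_empty, zsmul_zero]
  | cons a s ha ih => rw [Finset.sum_cons, Finset.sum_cons, zsmul_add, ih]

/-- Plumbing — peeling off the first pair: `θ(d, v) = d₀ · (v₀ ⌣ v₁) + θ(d ∘ succ, (v₂, …, v_{2k+1}))` for `v : Fin (2k+2) → H¹(A(ℂ); ℤ)`,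
`d : Fin (k+1) → ℤ`. [folklore] -/
private theorem sum_pair_succ_eq' (k : ℕ) (d : Fin (k + 1) → ℤ) (v : Fin (2 * (k + 1)) → singularCohomology ℤ ℤ (ComplexPoints A.X) 1) :
    ∑ i : Fin (k + 1), d i • cupProduct (rfl : 1 + 1 = 2) (v ⟨2 * (i : ℕ), by omega⟩) (v ⟨2 * (i : ℕ) + 1, by omega⟩) =
      d 0 • cupProduct (rfl : 1 + 1 = 2) (v ⟨0, by omega⟩) (v ⟨1, by omega⟩) +
        ∑ i : Fin k, d i.succ • cupProduct (rfl : 1 + 1 = 2) ((fun j : Fin (2 * k) ↦ v ⟨(j : ℕ) + 2, by omega⟩) ⟨2 * (i : ℕ), by omega⟩)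
          ((fun j : Fin (2 * k) ↦ v ⟨(j : ℕ) + 2, by omega⟩) ⟨2 * (i : ℕ) + 1, by omega⟩) := by
  rw [Fin.sum_univ_succ]
  rfl

/-- Plumbing: the value of `Fin.succAbove i j` — `j` if `j < i`, else `j + 1`. [folklore] -/
private theorem val_succAbove' {n : ℕ} (i : Fin (n + 1)) (j : Fin n) :
    ((i.succAbove j : Fin (n + 1)) : ℕ) = if (j : ℕ) < (i : ℕ) then (j : ℕ) else (j : ℕ) + 1 := by
  by_cases h : j.castSucc < i
  · rw [Fin.succAbove_of_castSucc_lt _ _ h, if_pos (by simpa [Fin.lt_def] using h), Fin.val_castSucc]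
  · rw [Fin.succAbove_of_le_castSucc _ _ (not_lt.1 h), if_neg (by simpa [Fin.lt_def] using h), Fin.val_succ]

/-- Re-indexing: omitting the pair `0` is the shift by two, `v^{(0)} = (v₂, v₃, …, v_{2k+1})`. [folklore] -/
private theorem omitPair_zero_eq (k : ℕ) (v : Fin (2 * (k + 1)) → singularCohomology ℤ ℤ (ComplexPoints A.X) 1) :
    (fun t : Fin (2 * k) ↦ v ⟨2 * ((0 : Fin (k + 1)).succAbove ⟨(t : ℕ) / 2, by omega⟩ : ℕ) + (t : ℕ) % 2, by omega⟩) =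
      fun j : Fin (2 * k) ↦ v ⟨(j : ℕ) + 2, by omega⟩ := by
  funext t
  congr 1
  apply Fin.ext
  simp only [val_succAbove', Fin.val_zero]
  split_ifs <;> omega

/-- **`m_{2k+2}(v^{(i+1)}) = (v₀ ⌣ v₁) ⌣ m_{2k}((v₂, v₃, …)^{(i)})`**: the cup monomial of the family with the pair `i+1` omitted splits off the pair `0`
(re-indexing through `Fin.succ_succAbove_zero` ∕ `Fin.succ_succAbove_succ`). [cite: HatcherAT2002, §3.2 Prop. 3.10 and Example 3.16] -/
theorem cupPowOne_omitPair_succ_eq (k : ℕ) (v : Fin (2 * (k + 1 + 1)) → singularCohomology ℤ ℤ (ComplexPoints A.X) 1) (i : Fin (k + 1)) :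
    cupPowOne ℤ (ComplexPoints A.X) (2 * (k + 1))
        (fun s : Fin (2 * (k + 1)) ↦ v ⟨2 * (i.succ.succAbove ⟨(s : ℕ) / 2, by omega⟩ : ℕ) + (s : ℕ) % 2, by omega⟩) =
      cupProduct (show 2 + 2 * k = 2 * (k + 1) by ring) (cupProduct (rfl : 1 + 1 = 2) (v ⟨0, by omega⟩) (v ⟨1, by omega⟩))
        (cupPowOne ℤ (ComplexPoints A.X) (2 * k) fun s : Fin (2 * k) ↦ (fun j : Fin (2 * (k + 1)) ↦ v ⟨(j : ℕ) + 2, by omega⟩)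
          ⟨2 * (i.succAbove ⟨(s : ℕ) / 2, by omega⟩ : ℕ) + (s : ℕ) % 2, by omega⟩) := by
  rw [cupPowOne_two_mul_succ_eq_cupProduct A k]
  have h0 : v ⟨2 * (i.succ.succAbove ⟨((⟨0, by omega⟩ : Fin (2 * (k + 1))) : ℕ) / 2, by omega⟩ : ℕ) +
      ((⟨0, by omega⟩ : Fin (2 * (k + 1))) : ℕ) % 2, by omega⟩ = v ⟨0, by omega⟩ := by
    congr 1
    apply Fin.ext
    simp only [val_succAbove', Fin.val_succ]
    split_ifs <;> omega
  have h1 : v ⟨2 * (i.succ.succAbove ⟨((⟨1, by omega⟩ : Fin (2 * (k + 1))) : ℕ) / 2, by omega⟩ : ℕ) +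
      ((⟨1, by omega⟩ : Fin (2 * (k + 1))) : ℕ) % 2, by omega⟩ = v ⟨1, by omega⟩ := by
    congr 1
    apply Fin.ext
    simp only [val_succAbove', Fin.val_succ]
    split_ifs <;> omega
  have h2 : (fun j : Fin (2 * k) ↦ v ⟨2 * (i.succ.succAbove ⟨((⟨(j : ℕ) + 2, by omega⟩ : Fin (2 * (k + 1))) : ℕ) / 2, by omega⟩ : ℕ) +
      ((⟨(j : ℕ) + 2, by omega⟩ : Fin (2 * (k + 1))) : ℕ) % 2, by omega⟩) =
      fun s : Fin (2 * k) ↦ (fun j : Fin (2 * (k + 1)) ↦ v ⟨(j : ℕ) + 2, by omega⟩)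
        ⟨2 * (i.succAbove ⟨(s : ℕ) / 2, by omega⟩ : ℕ) + (s : ℕ) % 2, by omega⟩ := by
    funext t
    congr 1
    apply Fin.ext
    simp only [val_succAbove', Fin.val_succ]
    split_ifs <;> omega
  rw [h0, h1, h2]

/-- `∏_{l<k} d_{s₀(l)} = ∏_{l<k} d_{l+1}`. [folklore] -/
private theorem prod_succAbove_zero_eq (k : ℕ) (d : Fin (k + 1) → ℤ) : ∏ l : Fin k, d ((0 : Fin (k + 1)).succAbove l) = ∏ l : Fin k, d l.succ := by
  simp only [Fin.succAbove_zero]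

/-- `∏_{l<k+1} d_{s_{i+1}(l)} = d₀ · ∏_{l<k} d_{s_i(l)+1}`. [folklore] -/
private theorem prod_succAbove_succ_eq (k : ℕ) (d : Fin (k + 1 + 1) → ℤ) (i : Fin (k + 1)) :
    ∏ l : Fin (k + 1), d (i.succ.succAbove l) = d 0 * ∏ l : Fin k, d (i.succAbove l).succ := by
  rw [Fin.prod_univ_succ, Fin.succ_succAbove_zero]
  simp only [Fin.succ_succAbove_succ]

/-! ### §2 The identity `θ^{⌣k} = k!·Σᵢ (∏_{l≠i} d_l)·m_{2k}(v^{(i)})` for a `(k+1)`-pair normal form -/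

/-- **THE PENULTIMATE POWER OF A `2`-CLASS IN NORMAL FORM: `θ(d, v)^{⌣k} = k! · Σ_{i ≤ k} (∏_{l<k} d_{sᵢ(l)}) · m_{2k}(v^{(i)})`** in `H^{2k}(A(ℂ); ℤ)`, for every family
`v : Fin (2k+2) → H¹(A(ℂ); ℤ)` and integers `d₀, …, d_k` (`sᵢ = Fin.succAbove i` enumerates the indices `≠ i`; `v^{(i)}` is `v` with the pair `(v_{2i}, v_{2i+1})` omitted)
— Lange's «`∧^g c₁(L) = (−1)^g g! d₁⋯d_g dx₁∧dy₁∧⋯∧dx_g∧dy_g`» one degree down, `∧^{g−1}(Σ dᵢ dxᵢ∧dyᵢ) = (g−1)! Σᵢ (∏_{ν≠i} d_ν) ⋀_{ν≠i} dx_ν∧dy_ν`, on the integral algebraic carrier.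
Proof: peel `θ = d₀(v₀ ⌣ v₁) + θ'`, `(a + θ')^{⌣(k+1)} = θ'^{⌣(k+1)} + (k+1)·a ⌣ θ'^{⌣k}` for the square-zero summand `a`, the top power of `θ'` and induction.
[cite: Lange2023AbelianVarietiesComplex, §1.7 Thm. 1.7.3 and its proof (PDF p. 73), Lemma 1.7.5] [cite: Lange2023AbelianVarietiesComplex, §4.2 Thm. 4.2.2 (Poincaré's formula)]
[cite: HatcherAT2002, §3.2 Prop. 3.10, Thm. 3.11 and Example 3.16] -/
theorem cupPowL_sum_pair_succ_eq_factorial_smul_sum : ∀ (k : ℕ) (d : Fin (k + 1) → ℤ) (v : Fin (2 * (k + 1)) → singularCohomology ℤ ℤ (ComplexPoints A.X) 1),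
    cupPowL (∑ i : Fin (k + 1), d i • cupProduct (rfl : 1 + 1 = 2) (v ⟨2 * (i : ℕ), by omega⟩) (v ⟨2 * (i : ℕ) + 1, by omega⟩)) k =
      (k.factorial : ℤ) • ∑ i : Fin (k + 1), (∏ l : Fin k, d (i.succAbove l)) •
        cupPowOne ℤ (ComplexPoints A.X) (2 * k) (fun t : Fin (2 * k) ↦ v ⟨2 * (i.succAbove ⟨(t : ℕ) / 2, by omega⟩ : ℕ) + (t : ℕ) % 2, by omega⟩)
  | 0, d, v => by
    rw [cupPowL_zero, Nat.factorial_zero, Nat.cast_one, one_smul, Fin.sum_univ_one, Finset.univ_eq_empty, Finset.prod_empty, one_smul,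
      cupPowOne_zero]
  | k + 1, d, v => by
    -- peel off the first pair and expand with the square-zero summand `a = d₀·(v₀ ⌣ v₁)`
    rw [sum_pair_succ_eq', cupPowL_add_succ_of_sq_zero _ _ (cupProduct_zsmul_pair_self_eq_zero A _ _ _)]
    beta_reduce
    -- the top power of `θ'` (g46-#3) and the induction hypothesis for `θ'^{⌣k}`
    rw [cupPowL_sum_pair_eq_factorial_mul_prod_smul_cupPowOne A (k + 1) (fun i ↦ d i.succ) (fun j : Fin (2 * (k + 1)) ↦ v ⟨(j : ℕ) + 2, by omega⟩),
      cupPowL_sum_pair_succ_eq_factorial_smul_sum k (fun i ↦ d i.succ) (fun j : Fin (2 * (k + 1)) ↦ v ⟨(j : ℕ) + 2, by omega⟩)]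
    -- the right-hand side, split at `i = 0`
    conv_rhs => rw [Fin.sum_univ_succ, prod_succAbove_zero_eq, omitPair_zero_eq A (k + 1) v]
    simp only [prod_succAbove_succ_eq, cupPowOne_omitPair_succ_eq A k v]
    -- bilinearity: `a ⌣ (k!·Σᵢ cᵢ·Yᵢ) = d₀·k!·Σᵢ cᵢ·(v₀ ⌣ v₁) ⌣ Yᵢ`
    rw [cupProduct_zsmul_left', cupProduct_zsmul_right', cupProduct_sum_right']
    simp only [cupProduct_zsmul_right']
    -- comparison of the integer coefficients
    rw [← natCast_zsmul, smul_smul, smul_smul, zsmul_sum', zsmul_add, smul_smul, zsmul_sum']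
    simp only [smul_smul]
    congr 1
    apply Finset.sum_congr rfl
    intro i _
    congr 1
    push_cast [Nat.factorial_succ]
    ring

/-- **Principal type: `(Σ_{i≤k} v_{2i} ⌣ v_{2i+1})^{⌣k} = k! · Σ_{i≤k} m_{2k}(v^{(i)})`** (all `dᵢ = 1`) — the divided power `θ^{g−1}/(g−1)!` of a principal class is the sum of the
`g` pair-omitting cup monomials («`[W̃₁] = θ^{g−1}/(g−1)!`», Poincaré's formula at `n = 1`). [cite: Lange2023AbelianVarietiesComplex, §4.2 Thm. 4.2.2 (PDF p. 203)]
[cite: Lange2023AbelianVarietiesComplex, §1.7 proof of Thm. 1.7.3] [cite: HatcherAT2002, §3.2 Example 3.16] -/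
theorem cupPowL_sum_pair_succ_eq_factorial_smul_sum_principal (k : ℕ) (v : Fin (2 * (k + 1)) → singularCohomology ℤ ℤ (ComplexPoints A.X) 1) :
    cupPowL (∑ i : Fin (k + 1), cupProduct (rfl : 1 + 1 = 2) (v ⟨2 * (i : ℕ), by omega⟩) (v ⟨2 * (i : ℕ) + 1, by omega⟩)) k =
      (k.factorial : ℤ) • ∑ i : Fin (k + 1),
        cupPowOne ℤ (ComplexPoints A.X) (2 * k) (fun t : Fin (2 * k) ↦ v ⟨2 * (i.succAbove ⟨(t : ℕ) / 2, by omega⟩ : ℕ) + (t : ℕ) % 2, by omega⟩) := by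
  have h := cupPowL_sum_pair_succ_eq_factorial_smul_sum A k (fun _ ↦ 1) v
  simp only [one_smul, Finset.prod_const_one] at h
  exact h

/-- **`θ^{⌣k} = 0` for a `(k+1)`-pair normal form with TWO vanishing coefficients `dᵢ = d_j = 0`, `i ≠ j`** (every product `∏_{l≠i'} d_l` then contains a zero).
[cite: Lange2023AbelianVarietiesComplex, §1.7 proof of Thm. 1.7.3 (degenerate case, PDF p. 73)] -/
theorem cupPowL_sum_pair_succ_eq_zero_of_ne (k : ℕ) (d : Fin (k + 1) → ℤ) (v : Fin (2 * (k + 1)) → singularCohomology ℤ ℤ (ComplexPoints A.X) 1)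
    {i j : Fin (k + 1)} (hij : i ≠ j) (hi : d i = 0) (hj : d j = 0) :
    cupPowL (∑ i : Fin (k + 1), d i • cupProduct (rfl : 1 + 1 = 2) (v ⟨2 * (i : ℕ), by omega⟩) (v ⟨2 * (i : ℕ) + 1, by omega⟩)) k = 0 := by
  rw [cupPowL_sum_pair_succ_eq_factorial_smul_sum, Finset.sum_eq_zero fun i' _ ↦ ?_, zsmul_zero]
  -- one of `i`, `j` differs from `i'`, hence is `sᵢ'(l)` for some `l`
  have key : ∏ l : Fin k, d (i'.succAbove l) = 0 := by
    by_cases h : i = i'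
    · subst h
      obtain ⟨l, hl⟩ := Fin.exists_succAbove_eq hij.symm
      exact Finset.prod_eq_zero (Finset.mem_univ l) (by rw [hl, hj])
    · obtain ⟨l, hl⟩ := Fin.exists_succAbove_eq h
      exact Finset.prod_eq_zero (Finset.mem_univ l) (by rw [hl, hi])
  rw [key, zero_zsmul]

/-! ### §3 Multiplying back the omitted pair: `(v_{2i} ⌣ v_{2i+1}) ⌣ θ^{⌣k} = k!·(∏_{l≠i} d_l)·m_{2k+2}(v)` -/

/-- Re-indexing: the omitted-pair family is a double omission, `v^{(i)} = (v ∘ s_{2i}) ∘ s_{2i}` (first drop `v_{2i}`, then the entry `v_{2i+1}`, which has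
moved to position `2i`). [folklore] -/
private theorem omitPair_eq_comp_succAbove_succAbove (k : ℕ) (v : Fin (2 * (k + 1)) → singularCohomology ℤ ℤ (ComplexPoints A.X) 1) (i : Fin (k + 1)) :
    (fun t : Fin (2 * k) ↦ v ⟨2 * (i.succAbove ⟨(t : ℕ) / 2, by omega⟩ : ℕ) + (t : ℕ) % 2, by omega⟩) =
      ((fun s : Fin (2 * k + 1) ↦ v ((⟨2 * (i : ℕ), by omega⟩ : Fin (2 * k + 1 + 1)).succAbove s)) ∘
        (⟨2 * (i : ℕ), by omega⟩ : Fin (2 * k + 1)).succAbove) := by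
  funext t
  simp only [Function.comp_apply]
  congr 1
  apply Fin.ext
  simp only [val_succAbove']
  split_ifs <;> omega

/-- **`(v_{2i} ⌣ v_{2i+1}) ⌣ m_{2k}(v^{(i)}) = m_{2k+2}(v)`**: multiplying the omitted pair back in front restores the full cup monomial (the pair has even
degree, so no sign: twice the cofactor sign `(−1)^{2i}`). [cite: BourbakiAlgebraI1989, Ch. III §7 no. 8 (19)–(20)] [cite: HatcherAT2002, §3.2 Example 3.16] -/
theorem cupProduct_pair_cupPowOne_omitPair (k : ℕ) (v : Fin (2 * (k + 1)) → singularCohomology ℤ ℤ (ComplexPoints A.X) 1) (i : Fin (k + 1)) :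
    cupProduct (show 2 + 2 * k = 2 * (k + 1) by ring) (cupProduct (rfl : 1 + 1 = 2) (v ⟨2 * (i : ℕ), by omega⟩) (v ⟨2 * (i : ℕ) + 1, by omega⟩))
        (cupPowOne ℤ (ComplexPoints A.X) (2 * k) (fun t : Fin (2 * k) ↦ v ⟨2 * (i.succAbove ⟨(t : ℕ) / 2, by omega⟩ : ℕ) + (t : ℕ) % 2, by omega⟩)) =
      cupPowOne ℤ (ComplexPoints A.X) (2 * (k + 1)) v := by
  rw [cupProduct_assoc (rfl : 1 + 1 = 2) (Nat.add_comm 1 (2 * k)) (show 2 + 2 * k = 2 * (k + 1) by ring) (show 1 + (2 * k + 1) = 2 * (k + 1) by ring),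
    omitPair_eq_comp_succAbove_succAbove A k v i]
  -- the entry `v_{2i+1}` sits at position `2i` of the once-shortened family
  have hu : v ⟨2 * (i : ℕ) + 1, by omega⟩ =
      (fun s : Fin (2 * k + 1) ↦ v ((⟨2 * (i : ℕ), by omega⟩ : Fin (2 * k + 1 + 1)).succAbove s)) (⟨2 * (i : ℕ), by omega⟩ : Fin (2 * k + 1)) := by
    congr 1
    apply Fin.ext
    simp only [val_succAbove']
    split_ifs <;> omega
  have heven : ((-1 : ℤ) ^ (((⟨2 * (i : ℕ), by omega⟩ : Fin (2 * k + 1)) : ℕ))) = 1 := by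
    simp only [pow_mul, neg_one_sq, one_pow]
  have heven' : ((-1 : ℤ) ^ (((⟨2 * (i : ℕ), by omega⟩ : Fin (2 * k + 1 + 1)) : ℕ))) = 1 := by
    simp only [pow_mul, neg_one_sq, one_pow]
  rw [hu, cupProduct_cupPowOne_succAbove_self A (k := 2 * k)
    (fun s : Fin (2 * k + 1) ↦ v ((⟨2 * (i : ℕ), by omega⟩ : Fin (2 * k + 1 + 1)).succAbove s)) (⟨2 * (i : ℕ), by omega⟩ : Fin (2 * k + 1)),
    heven, one_smul]
  show cupProduct (Nat.add_comm 1 (2 * k + 1)) (v ⟨2 * (i : ℕ), by omega⟩)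
      (cupPowOne ℤ (ComplexPoints A.X) (2 * k + 1) (v ∘ (⟨2 * (i : ℕ), by omega⟩ : Fin (2 * k + 1 + 1)).succAbove)) =
    cupPowOne ℤ (ComplexPoints A.X) (2 * k + 1 + 1) v
  rw [cupProduct_cupPowOne_succAbove_self A (k := 2 * k + 1) v (⟨2 * (i : ℕ), by omega⟩ : Fin (2 * k + 1 + 1)), heven', one_smul]

/-- **`(v_{2i} ⌣ v_{2i+1}) ⌣ m_{2k}(v^{(l)}) = 0` for `l ≠ i`**: the pair `i` then occurs among the factors of `v^{(l)}` («`αᵢ² = 0`»).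
[cite: HatcherAT2002, §3.2 Example 3.16] [cite: Lange2023AbelianVarietiesComplex, §1.1.3 Lemma 1.1.17 (b)] -/
theorem cupProduct_pair_cupPowOne_omitPair_of_ne (k : ℕ) (v : Fin (2 * (k + 1)) → singularCohomology ℤ ℤ (ComplexPoints A.X) 1)
    {i l : Fin (k + 1)} (hil : i ≠ l) :
    cupProduct (show 2 + 2 * k = 2 * (k + 1) by ring) (cupProduct (rfl : 1 + 1 = 2) (v ⟨2 * (i : ℕ), by omega⟩) (v ⟨2 * (i : ℕ) + 1, by omega⟩))
        (cupPowOne ℤ (ComplexPoints A.X) (2 * k) (fun t : Fin (2 * k) ↦ v ⟨2 * (l.succAbove ⟨(t : ℕ) / 2, by omega⟩ : ℕ) + (t : ℕ) % 2, by omega⟩)) = 0 := by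
  rw [cupProduct_assoc (rfl : 1 + 1 = 2) (Nat.add_comm 1 (2 * k)) (show 2 + 2 * k = 2 * (k + 1) by ring) (show 1 + (2 * k + 1) = 2 * (k + 1) by ring)]
  obtain ⟨q, hq⟩ := Fin.exists_succAbove_eq hil
  -- `v_{2i+1}` is the entry of index `2q+1` of `v^{(l)}`, `s_l(q) = i`
  have hp : v ⟨2 * (i : ℕ) + 1, by omega⟩ =
      (fun t : Fin (2 * k) ↦ v ⟨2 * (l.succAbove ⟨(t : ℕ) / 2, by omega⟩ : ℕ) + (t : ℕ) % 2, by omega⟩) ⟨2 * (q : ℕ) + 1, by omega⟩ := by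
    have hq' : (⟨(2 * (q : ℕ) + 1) / 2, by omega⟩ : Fin k) = q := Fin.ext (by simp; omega)
    simp only [hq', hq]
    congr 1
    apply Fin.ext
    simp only
    omega
  rw [hp, cup_cupPowOne_eq_zero_of_sq_zero (cupProduct_self_eq_zero_int A) (2 * k)
    (fun t : Fin (2 * k) ↦ v ⟨2 * (l.succAbove ⟨(t : ℕ) / 2, by omega⟩ : ℕ) + (t : ℕ) % 2, by omega⟩) ⟨2 * (q : ℕ) + 1, by omega⟩, map_zero]

/-- **`(v_{2i} ⌣ v_{2i+1}) ⌣ θ(d, v)^{⌣k} = (k! · ∏_{l<k} d_{sᵢ(l)}) · m_{2k+2}(v)`** — the omitted pair multiplies the penultimate power back to the TOP monomial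
with the complementary coefficient `∏_{l≠i} d_l` (on a Jacobian: the intersection numbers of `θ^{g−1}/(g−1)!` with the coordinate `2`-classes).
[cite: Lange2023AbelianVarietiesComplex, §1.7 Thm. 1.7.3 and its proof (PDF p. 73)] [cite: Lange2023AbelianVarietiesComplex, §4.2 Thm. 4.2.2]
[cite: HatcherAT2002, §3.2 Prop. 3.10 and Example 3.16] -/
theorem cupProduct_pair_cupPowL_sum_pair_succ (k : ℕ) (d : Fin (k + 1) → ℤ) (v : Fin (2 * (k + 1)) → singularCohomology ℤ ℤ (ComplexPoints A.X) 1)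
    (i : Fin (k + 1)) :
    cupProduct (show 2 + 2 * k = 2 * (k + 1) by ring) (cupProduct (rfl : 1 + 1 = 2) (v ⟨2 * (i : ℕ), by omega⟩) (v ⟨2 * (i : ℕ) + 1, by omega⟩))
        (cupPowL (∑ i : Fin (k + 1), d i • cupProduct (rfl : 1 + 1 = 2) (v ⟨2 * (i : ℕ), by omega⟩) (v ⟨2 * (i : ℕ) + 1, by omega⟩)) k) =
      ((k.factorial : ℤ) * ∏ l : Fin k, d (i.succAbove l)) • cupPowOne ℤ (ComplexPoints A.X) (2 * (k + 1)) v := by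
  rw [cupPowL_sum_pair_succ_eq_factorial_smul_sum, cupProduct_zsmul_right', cupProduct_sum_right',
    Finset.sum_eq_single i (fun l _ hli ↦ ?_) (fun h ↦ absurd (Finset.mem_univ i) h), cupProduct_zsmul_right',
    cupProduct_pair_cupPowOne_omitPair, smul_smul]
  rw [cupProduct_zsmul_right', cupProduct_pair_cupPowOne_omitPair_of_ne A k v (Ne.symm hli), zsmul_zero]

/-- **Principal case: `(v_{2i} ⌣ v_{2i+1}) ⌣ (Σ_l v_{2l} ⌣ v_{2l+1})^{⌣k} = k! · m_{2k+2}(v)`** for every `i ≤ k`.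
[cite: Lange2023AbelianVarietiesComplex, §4.2 Thm. 4.2.2 (PDF p. 203)] [cite: HatcherAT2002, §3.2 Example 3.16] -/
theorem cupProduct_pair_cupPowL_sum_pair_succ_principal (k : ℕ) (v : Fin (2 * (k + 1)) → singularCohomology ℤ ℤ (ComplexPoints A.X) 1)
    (i : Fin (k + 1)) :
    cupProduct (show 2 + 2 * k = 2 * (k + 1) by ring) (cupProduct (rfl : 1 + 1 = 2) (v ⟨2 * (i : ℕ), by omega⟩) (v ⟨2 * (i : ℕ) + 1, by omega⟩))
        (cupPowL (∑ i : Fin (k + 1), cupProduct (rfl : 1 + 1 = 2) (v ⟨2 * (i : ℕ), by omega⟩) (v ⟨2 * (i : ℕ) + 1, by omega⟩)) k) =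
      (k.factorial : ℤ) • cupPowOne ℤ (ComplexPoints A.X) (2 * (k + 1)) v := by
  have h := cupProduct_pair_cupPowL_sum_pair_succ A k (fun _ ↦ 1) v i
  simp only [one_smul, Finset.prod_const_one, mul_one] at h
  exact h

end AbelianVariety

end Literature.AlgebraicGeometry.HodgeTheory

end
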